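import Summits.Ventures.YMGap.RobustBall.StarWindowZdWRowsSU2
import Summits.Ventures.YMGap.RobustBall.StarBoundaryDecayZdW
import HarnessLib

/-!
# Venture YMGap, track ROBUST-BALL (Y2) — THE `SU(2)` TIER-2 `ℤ⁴` TABLE, CELL BY CELL: BOUNDARY DECAY — every member of the
# weighted ball forgets its boundary field (RBS rows 1v′ / T6B numbers), up to `β_W = 1/3`

HONEST FRAMING. WHAT THIS IS: a venture file (cell `pub-ymgap`, track Y2 ROBUST-BALL, seat ds-2): the window cells
`su2_starWindowBoundZdW_star_<cell>` (`StarWindowZdWRowsSU2.lean`) fed into ds-3's door-level boundary-decay theorems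
(`StarBoundaryDecayZdW.lean`: `abs_kernel_sub_kernel_le_of_starWindowBoundZdW`, `abs_kernel_sub_integral_le_of_starWindowBoundZdW`).
For each cell `(β_W, ε)` ∈ {(1/10,.173) (1/8,.148) (1/6,.111) (1/5,.086) (1/4,.054) (3/10,.027) (1/3,.011)}, EVERY member `W` of
`MemBallZdW (1/100) (2ε) ε`, every finite link volume `Λ₀`, every `1`-Lipschitz depth function `φ` positive only on `Λ₀`, every bounded
measurable `F` reading `Δ ⊆ Λ₀` with link-Lipschitz vector `δ` at depth `φ ≥ m` on `Δ`:
* `su2_boundaryDecay_onBallZdW_star_<cell>` — two boundary fields: `|∫F dγ^W_{Λ₀}(·|ω) − ∫F dγ^W_{Λ₀}(·|η)| ≤ 2√2 e^{t} e^{−t m} Σ δ`;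
* `su2_boundaryDLR_onBallZdW_star_<cell>` — versus every DLR state `μ`: `|∫F dγ^W_{Λ₀}(·|η) − ∫F dμ| ≤ 2√2 e^{t} e^{−t m} Σ δ`,
with the cell's door rate `t = 10⁻⁶` (tree coupling `β_W/2`, kernels `perturbedYMS (fundamentalRep (Fin 2)) (β_W/2) W`). WHAT THIS IS NOT:
the rate is the door rate (a tiny door artefact: boundary independence at a rate, not a useful decay length); lattice strong coupling;
nothing about the continuum or the Millennium problem.
-/

noncomputable section

open MeasureTheory ProbabilityTheory Function Finset Real
open scoped NNReal
open Literature.Probability.LatticeModels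
open Literature.Probability.LatticeModels.DobrushinMetric (IsLipBound)
open Literature.MathematicalPhysics.QuantumLattice hiding torusNorm
open Literature.MathematicalPhysics.QuantumFieldTheory hiding ZdEdge
open Summit.Ventures.YMGap.DSWindowZd

namespace Summit.Ventures.YMGap.RobustBall

/-- **BOUNDARY DECAY, two boundary fields** (`β_W = 1 / 10`, ball `MemBallZdW (1/100) (173 / 500) (173 / 1000)`, rate `10⁻⁶`). [folklore] -/
theorem su2_boundaryDecay_onBallZdW_star_oneTenth {W : Potential (ZdEdge 4) (SUN 2)}
    (hW : MemBallZdW (1 / 100) (173 / 500) (173 / 1000) W) (Λ₀ : Finset (ZdEdge 4)) (ω η : LGConfig 4 (SUN 2)) (φ : ZdEdge 4 → ℝ)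
    (hφ : ∀ x y : ZdEdge 4, φ x ≤ φ y + ‖x.1 - y.1‖) (hφΛ : ∀ x, 0 < φ x → x ∈ Λ₀)
    {F : LGConfig 4 (SUN 2) → ℝ} (hFm : Measurable F) {B : ℝ} (hB : ∀ σ, |F σ| ≤ B) {Δ : Finset (ZdEdge 4)}
    (hFdep : DependsOn F (Δ : Set (ZdEdge 4))) {δ : ZdEdge 4 → ℝ} (hδ : IsLipBound suFrobDist F δ) (hΔ : Δ ⊆ Λ₀) {m : ℝ}
    (hm : ∀ x ∈ Δ, m ≤ φ x) :
    |∫ σ, F σ ∂(perturbedYMS (d := 4) (fundamentalRep (Fin 2)) (1 / 20) W Λ₀ ω) -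
        ∫ σ, F σ ∂(perturbedYMS (d := 4) (fundamentalRep (Fin 2)) (1 / 20) W Λ₀ η)| ≤
      2 * Real.sqrt 2 * Real.exp (1 / 1000000) * Real.exp (-(1 / 1000000 * m)) * ∑ x ∈ Δ, δ x := by
  obtain ⟨Bm, hBm⟩ := hW.summable
  have e : ((2 : ℕ) : ℝ) * ((1 / 10 : ℝ) / 4) = 1 / 20 := by norm_num
  have hdoor := su2_starWindowBoundZdW_star_oneTenth W hW
  rw [e] at hdoor
  have h := abs_kernel_sub_kernel_le_of_starWindowBoundZdW
    (isSpecification_perturbedYMS _ (continuous_fundamentalRep (Fin 2)) _ hBm hW.continuous hW.dependsOn)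
    (by norm_num) (by norm_num) (by norm_num) starReach_nonneg (fun s x hx y => norm_sub_le_starReach s hx y) hdoor
    Λ₀ ω η φ hφ hφΛ hFm hB hFdep hδ hΔ hm
  simpa using h

/-- **BOUNDARY DECAY versus every DLR state** (`β_W = 1 / 10`, same ball and rate). [folklore] -/
theorem su2_boundaryDLR_onBallZdW_star_oneTenth {W : Potential (ZdEdge 4) (SUN 2)}
    (hW : MemBallZdW (1 / 100) (173 / 500) (173 / 1000) W) {μ : Measure (LGConfig 4 (SUN 2))}
    (hμ : μ ∈ perturbedGibbsMeasuresS (d := 4) (fundamentalRep (Fin 2)) (1 / 20) W)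
    (Λ₀ : Finset (ZdEdge 4)) (η : LGConfig 4 (SUN 2)) (φ : ZdEdge 4 → ℝ)
    (hφ : ∀ x y : ZdEdge 4, φ x ≤ φ y + ‖x.1 - y.1‖) (hφΛ : ∀ x, 0 < φ x → x ∈ Λ₀)
    {F : LGConfig 4 (SUN 2) → ℝ} (hFm : Measurable F) {B : ℝ} (hB : ∀ σ, |F σ| ≤ B) {Δ : Finset (ZdEdge 4)}
    (hFdep : DependsOn F (Δ : Set (ZdEdge 4))) {δ : ZdEdge 4 → ℝ} (hδ : IsLipBound suFrobDist F δ) (hΔ : Δ ⊆ Λ₀) {m : ℝ}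
    (hm : ∀ x ∈ Δ, m ≤ φ x) :
    |(∫ σ, F σ ∂(perturbedYMS (d := 4) (fundamentalRep (Fin 2)) (1 / 20) W Λ₀ η)) - ∫ σ, F σ ∂μ| ≤
      2 * Real.sqrt 2 * Real.exp (1 / 1000000) * Real.exp (-(1 / 1000000 * m)) * ∑ x ∈ Δ, δ x := by
  obtain ⟨Bm, hBm⟩ := hW.summable
  have e : ((2 : ℕ) : ℝ) * ((1 / 10 : ℝ) / 4) = 1 / 20 := by norm_num
  have hdoor := su2_starWindowBoundZdW_star_oneTenth W hW
  rw [e] at hdoor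
  have h := abs_kernel_sub_integral_le_of_starWindowBoundZdW
    (isSpecification_perturbedYMS _ (continuous_fundamentalRep (Fin 2)) _ hBm hW.continuous hW.dependsOn)
    (by norm_num) (by norm_num) (by norm_num) starReach_nonneg (fun s x hx y => norm_sub_le_starReach s hx y) hdoor hμ
    Λ₀ η φ hφ hφΛ hFm hB hFdep hδ hΔ hm
  simpa using h

/-- **BOUNDARY DECAY, two boundary fields** (`β_W = 1 / 8`, ball `MemBallZdW (1/100) (37 / 125) (37 / 250)`, rate `10⁻⁶`). [folklore] -/
theorem su2_boundaryDecay_onBallZdW_star_oneEighth {W : Potential (ZdEdge 4) (SUN 2)}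
    (hW : MemBallZdW (1 / 100) (37 / 125) (37 / 250) W) (Λ₀ : Finset (ZdEdge 4)) (ω η : LGConfig 4 (SUN 2)) (φ : ZdEdge 4 → ℝ)
    (hφ : ∀ x y : ZdEdge 4, φ x ≤ φ y + ‖x.1 - y.1‖) (hφΛ : ∀ x, 0 < φ x → x ∈ Λ₀)
    {F : LGConfig 4 (SUN 2) → ℝ} (hFm : Measurable F) {B : ℝ} (hB : ∀ σ, |F σ| ≤ B) {Δ : Finset (ZdEdge 4)}
    (hFdep : DependsOn F (Δ : Set (ZdEdge 4))) {δ : ZdEdge 4 → ℝ} (hδ : IsLipBound suFrobDist F δ) (hΔ : Δ ⊆ Λ₀) {m : ℝ}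
    (hm : ∀ x ∈ Δ, m ≤ φ x) :
    |∫ σ, F σ ∂(perturbedYMS (d := 4) (fundamentalRep (Fin 2)) (1 / 16) W Λ₀ ω) -
        ∫ σ, F σ ∂(perturbedYMS (d := 4) (fundamentalRep (Fin 2)) (1 / 16) W Λ₀ η)| ≤
      2 * Real.sqrt 2 * Real.exp (1 / 1000000) * Real.exp (-(1 / 1000000 * m)) * ∑ x ∈ Δ, δ x := by
  obtain ⟨Bm, hBm⟩ := hW.summable
  have e : ((2 : ℕ) : ℝ) * ((1 / 8 : ℝ) / 4) = 1 / 16 := by norm_num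
  have hdoor := su2_starWindowBoundZdW_star_oneEighth W hW
  rw [e] at hdoor
  have h := abs_kernel_sub_kernel_le_of_starWindowBoundZdW
    (isSpecification_perturbedYMS _ (continuous_fundamentalRep (Fin 2)) _ hBm hW.continuous hW.dependsOn)
    (by norm_num) (by norm_num) (by norm_num) starReach_nonneg (fun s x hx y => norm_sub_le_starReach s hx y) hdoor
    Λ₀ ω η φ hφ hφΛ hFm hB hFdep hδ hΔ hm
  simpa using h

/-- **BOUNDARY DECAY versus every DLR state** (`β_W = 1 / 8`, same ball and rate). [folklore] -/
theorem su2_boundaryDLR_onBallZdW_star_oneEighth {W : Potential (ZdEdge 4) (SUN 2)}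
    (hW : MemBallZdW (1 / 100) (37 / 125) (37 / 250) W) {μ : Measure (LGConfig 4 (SUN 2))}
    (hμ : μ ∈ perturbedGibbsMeasuresS (d := 4) (fundamentalRep (Fin 2)) (1 / 16) W)
    (Λ₀ : Finset (ZdEdge 4)) (η : LGConfig 4 (SUN 2)) (φ : ZdEdge 4 → ℝ)
    (hφ : ∀ x y : ZdEdge 4, φ x ≤ φ y + ‖x.1 - y.1‖) (hφΛ : ∀ x, 0 < φ x → x ∈ Λ₀)
    {F : LGConfig 4 (SUN 2) → ℝ} (hFm : Measurable F) {B : ℝ} (hB : ∀ σ, |F σ| ≤ B) {Δ : Finset (ZdEdge 4)}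
    (hFdep : DependsOn F (Δ : Set (ZdEdge 4))) {δ : ZdEdge 4 → ℝ} (hδ : IsLipBound suFrobDist F δ) (hΔ : Δ ⊆ Λ₀) {m : ℝ}
    (hm : ∀ x ∈ Δ, m ≤ φ x) :
    |(∫ σ, F σ ∂(perturbedYMS (d := 4) (fundamentalRep (Fin 2)) (1 / 16) W Λ₀ η)) - ∫ σ, F σ ∂μ| ≤
      2 * Real.sqrt 2 * Real.exp (1 / 1000000) * Real.exp (-(1 / 1000000 * m)) * ∑ x ∈ Δ, δ x := by
  obtain ⟨Bm, hBm⟩ := hW.summable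
  have e : ((2 : ℕ) : ℝ) * ((1 / 8 : ℝ) / 4) = 1 / 16 := by norm_num
  have hdoor := su2_starWindowBoundZdW_star_oneEighth W hW
  rw [e] at hdoor
  have h := abs_kernel_sub_integral_le_of_starWindowBoundZdW
    (isSpecification_perturbedYMS _ (continuous_fundamentalRep (Fin 2)) _ hBm hW.continuous hW.dependsOn)
    (by norm_num) (by norm_num) (by norm_num) starReach_nonneg (fun s x hx y => norm_sub_le_starReach s hx y) hdoor hμ
    Λ₀ η φ hφ hφΛ hFm hB hFdep hδ hΔ hm
  simpa using h

/-- **BOUNDARY DECAY, two boundary fields** (`β_W = 1 / 6`, ball `MemBallZdW (1/100) (111 / 500) (111 / 1000)`, rate `10⁻⁶`). [folklore] -/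
theorem su2_boundaryDecay_onBallZdW_star_oneSixth {W : Potential (ZdEdge 4) (SUN 2)}
    (hW : MemBallZdW (1 / 100) (111 / 500) (111 / 1000) W) (Λ₀ : Finset (ZdEdge 4)) (ω η : LGConfig 4 (SUN 2)) (φ : ZdEdge 4 → ℝ)
    (hφ : ∀ x y : ZdEdge 4, φ x ≤ φ y + ‖x.1 - y.1‖) (hφΛ : ∀ x, 0 < φ x → x ∈ Λ₀)
    {F : LGConfig 4 (SUN 2) → ℝ} (hFm : Measurable F) {B : ℝ} (hB : ∀ σ, |F σ| ≤ B) {Δ : Finset (ZdEdge 4)}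
    (hFdep : DependsOn F (Δ : Set (ZdEdge 4))) {δ : ZdEdge 4 → ℝ} (hδ : IsLipBound suFrobDist F δ) (hΔ : Δ ⊆ Λ₀) {m : ℝ}
    (hm : ∀ x ∈ Δ, m ≤ φ x) :
    |∫ σ, F σ ∂(perturbedYMS (d := 4) (fundamentalRep (Fin 2)) (1 / 12) W Λ₀ ω) -
        ∫ σ, F σ ∂(perturbedYMS (d := 4) (fundamentalRep (Fin 2)) (1 / 12) W Λ₀ η)| ≤
      2 * Real.sqrt 2 * Real.exp (1 / 1000000) * Real.exp (-(1 / 1000000 * m)) * ∑ x ∈ Δ, δ x := by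
  obtain ⟨Bm, hBm⟩ := hW.summable
  have e : ((2 : ℕ) : ℝ) * ((1 / 6 : ℝ) / 4) = 1 / 12 := by norm_num
  have hdoor := su2_starWindowBoundZdW_star_oneSixth W hW
  rw [e] at hdoor
  have h := abs_kernel_sub_kernel_le_of_starWindowBoundZdW
    (isSpecification_perturbedYMS _ (continuous_fundamentalRep (Fin 2)) _ hBm hW.continuous hW.dependsOn)
    (by norm_num) (by norm_num) (by norm_num) starReach_nonneg (fun s x hx y => norm_sub_le_starReach s hx y) hdoor
    Λ₀ ω η φ hφ hφΛ hFm hB hFdep hδ hΔ hm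
  simpa using h

/-- **BOUNDARY DECAY versus every DLR state** (`β_W = 1 / 6`, same ball and rate). [folklore] -/
theorem su2_boundaryDLR_onBallZdW_star_oneSixth {W : Potential (ZdEdge 4) (SUN 2)}
    (hW : MemBallZdW (1 / 100) (111 / 500) (111 / 1000) W) {μ : Measure (LGConfig 4 (SUN 2))}
    (hμ : μ ∈ perturbedGibbsMeasuresS (d := 4) (fundamentalRep (Fin 2)) (1 / 12) W)
    (Λ₀ : Finset (ZdEdge 4)) (η : LGConfig 4 (SUN 2)) (φ : ZdEdge 4 → ℝ)
    (hφ : ∀ x y : ZdEdge 4, φ x ≤ φ y + ‖x.1 - y.1‖) (hφΛ : ∀ x, 0 < φ x → x ∈ Λ₀)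
    {F : LGConfig 4 (SUN 2) → ℝ} (hFm : Measurable F) {B : ℝ} (hB : ∀ σ, |F σ| ≤ B) {Δ : Finset (ZdEdge 4)}
    (hFdep : DependsOn F (Δ : Set (ZdEdge 4))) {δ : ZdEdge 4 → ℝ} (hδ : IsLipBound suFrobDist F δ) (hΔ : Δ ⊆ Λ₀) {m : ℝ}
    (hm : ∀ x ∈ Δ, m ≤ φ x) :
    |(∫ σ, F σ ∂(perturbedYMS (d := 4) (fundamentalRep (Fin 2)) (1 / 12) W Λ₀ η)) - ∫ σ, F σ ∂μ| ≤
      2 * Real.sqrt 2 * Real.exp (1 / 1000000) * Real.exp (-(1 / 1000000 * m)) * ∑ x ∈ Δ, δ x := by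
  obtain ⟨Bm, hBm⟩ := hW.summable
  have e : ((2 : ℕ) : ℝ) * ((1 / 6 : ℝ) / 4) = 1 / 12 := by norm_num
  have hdoor := su2_starWindowBoundZdW_star_oneSixth W hW
  rw [e] at hdoor
  have h := abs_kernel_sub_integral_le_of_starWindowBoundZdW
    (isSpecification_perturbedYMS _ (continuous_fundamentalRep (Fin 2)) _ hBm hW.continuous hW.dependsOn)
    (by norm_num) (by norm_num) (by norm_num) starReach_nonneg (fun s x hx y => norm_sub_le_starReach s hx y) hdoor hμ
    Λ₀ η φ hφ hφΛ hFm hB hFdep hδ hΔ hm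
  simpa using h

/-- **BOUNDARY DECAY, two boundary fields** (`β_W = 1 / 5`, ball `MemBallZdW (1/100) (43 / 250) (43 / 500)`, rate `10⁻⁶`). [folklore] -/
theorem su2_boundaryDecay_onBallZdW_star_oneFifth {W : Potential (ZdEdge 4) (SUN 2)}
    (hW : MemBallZdW (1 / 100) (43 / 250) (43 / 500) W) (Λ₀ : Finset (ZdEdge 4)) (ω η : LGConfig 4 (SUN 2)) (φ : ZdEdge 4 → ℝ)
    (hφ : ∀ x y : ZdEdge 4, φ x ≤ φ y + ‖x.1 - y.1‖) (hφΛ : ∀ x, 0 < φ x → x ∈ Λ₀)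
    {F : LGConfig 4 (SUN 2) → ℝ} (hFm : Measurable F) {B : ℝ} (hB : ∀ σ, |F σ| ≤ B) {Δ : Finset (ZdEdge 4)}
    (hFdep : DependsOn F (Δ : Set (ZdEdge 4))) {δ : ZdEdge 4 → ℝ} (hδ : IsLipBound suFrobDist F δ) (hΔ : Δ ⊆ Λ₀) {m : ℝ}
    (hm : ∀ x ∈ Δ, m ≤ φ x) :
    |∫ σ, F σ ∂(perturbedYMS (d := 4) (fundamentalRep (Fin 2)) (1 / 10) W Λ₀ ω) -
        ∫ σ, F σ ∂(perturbedYMS (d := 4) (fundamentalRep (Fin 2)) (1 / 10) W Λ₀ η)| ≤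
      2 * Real.sqrt 2 * Real.exp (1 / 1000000) * Real.exp (-(1 / 1000000 * m)) * ∑ x ∈ Δ, δ x := by
  obtain ⟨Bm, hBm⟩ := hW.summable
  have e : ((2 : ℕ) : ℝ) * ((1 / 5 : ℝ) / 4) = 1 / 10 := by norm_num
  have hdoor := su2_starWindowBoundZdW_star_oneFifth W hW
  rw [e] at hdoor
  have h := abs_kernel_sub_kernel_le_of_starWindowBoundZdW
    (isSpecification_perturbedYMS _ (continuous_fundamentalRep (Fin 2)) _ hBm hW.continuous hW.dependsOn)
    (by norm_num) (by norm_num) (by norm_num) starReach_nonneg (fun s x hx y => norm_sub_le_starReach s hx y) hdoor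
    Λ₀ ω η φ hφ hφΛ hFm hB hFdep hδ hΔ hm
  simpa using h

/-- **BOUNDARY DECAY versus every DLR state** (`β_W = 1 / 5`, same ball and rate). [folklore] -/
theorem su2_boundaryDLR_onBallZdW_star_oneFifth {W : Potential (ZdEdge 4) (SUN 2)}
    (hW : MemBallZdW (1 / 100) (43 / 250) (43 / 500) W) {μ : Measure (LGConfig 4 (SUN 2))}
    (hμ : μ ∈ perturbedGibbsMeasuresS (d := 4) (fundamentalRep (Fin 2)) (1 / 10) W)
    (Λ₀ : Finset (ZdEdge 4)) (η : LGConfig 4 (SUN 2)) (φ : ZdEdge 4 → ℝ)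
    (hφ : ∀ x y : ZdEdge 4, φ x ≤ φ y + ‖x.1 - y.1‖) (hφΛ : ∀ x, 0 < φ x → x ∈ Λ₀)
    {F : LGConfig 4 (SUN 2) → ℝ} (hFm : Measurable F) {B : ℝ} (hB : ∀ σ, |F σ| ≤ B) {Δ : Finset (ZdEdge 4)}
    (hFdep : DependsOn F (Δ : Set (ZdEdge 4))) {δ : ZdEdge 4 → ℝ} (hδ : IsLipBound suFrobDist F δ) (hΔ : Δ ⊆ Λ₀) {m : ℝ}
    (hm : ∀ x ∈ Δ, m ≤ φ x) :
    |(∫ σ, F σ ∂(perturbedYMS (d := 4) (fundamentalRep (Fin 2)) (1 / 10) W Λ₀ η)) - ∫ σ, F σ ∂μ| ≤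
      2 * Real.sqrt 2 * Real.exp (1 / 1000000) * Real.exp (-(1 / 1000000 * m)) * ∑ x ∈ Δ, δ x := by
  obtain ⟨Bm, hBm⟩ := hW.summable
  have e : ((2 : ℕ) : ℝ) * ((1 / 5 : ℝ) / 4) = 1 / 10 := by norm_num
  have hdoor := su2_starWindowBoundZdW_star_oneFifth W hW
  rw [e] at hdoor
  have h := abs_kernel_sub_integral_le_of_starWindowBoundZdW
    (isSpecification_perturbedYMS _ (continuous_fundamentalRep (Fin 2)) _ hBm hW.continuous hW.dependsOn)
    (by norm_num) (by norm_num) (by norm_num) starReach_nonneg (fun s x hx y => norm_sub_le_starReach s hx y) hdoor hμ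
    Λ₀ η φ hφ hφΛ hFm hB hFdep hδ hΔ hm
  simpa using h

/-- **BOUNDARY DECAY, two boundary fields** (`β_W = 1 / 4`, ball `MemBallZdW (1/100) (27 / 250) (27 / 500)`, rate `10⁻⁶`). [folklore] -/
theorem su2_boundaryDecay_onBallZdW_star_oneQuarter {W : Potential (ZdEdge 4) (SUN 2)}
    (hW : MemBallZdW (1 / 100) (27 / 250) (27 / 500) W) (Λ₀ : Finset (ZdEdge 4)) (ω η : LGConfig 4 (SUN 2)) (φ : ZdEdge 4 → ℝ)
    (hφ : ∀ x y : ZdEdge 4, φ x ≤ φ y + ‖x.1 - y.1‖) (hφΛ : ∀ x, 0 < φ x → x ∈ Λ₀)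
    {F : LGConfig 4 (SUN 2) → ℝ} (hFm : Measurable F) {B : ℝ} (hB : ∀ σ, |F σ| ≤ B) {Δ : Finset (ZdEdge 4)}
    (hFdep : DependsOn F (Δ : Set (ZdEdge 4))) {δ : ZdEdge 4 → ℝ} (hδ : IsLipBound suFrobDist F δ) (hΔ : Δ ⊆ Λ₀) {m : ℝ}
    (hm : ∀ x ∈ Δ, m ≤ φ x) :
    |∫ σ, F σ ∂(perturbedYMS (d := 4) (fundamentalRep (Fin 2)) (1 / 8) W Λ₀ ω) -
        ∫ σ, F σ ∂(perturbedYMS (d := 4) (fundamentalRep (Fin 2)) (1 / 8) W Λ₀ η)| ≤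
      2 * Real.sqrt 2 * Real.exp (1 / 1000000) * Real.exp (-(1 / 1000000 * m)) * ∑ x ∈ Δ, δ x := by
  obtain ⟨Bm, hBm⟩ := hW.summable
  have e : ((2 : ℕ) : ℝ) * ((1 / 4 : ℝ) / 4) = 1 / 8 := by norm_num
  have hdoor := su2_starWindowBoundZdW_star_oneQuarter W hW
  rw [e] at hdoor
  have h := abs_kernel_sub_kernel_le_of_starWindowBoundZdW
    (isSpecification_perturbedYMS _ (continuous_fundamentalRep (Fin 2)) _ hBm hW.continuous hW.dependsOn)
    (by norm_num) (by norm_num) (by norm_num) starReach_nonneg (fun s x hx y => norm_sub_le_starReach s hx y) hdoor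
    Λ₀ ω η φ hφ hφΛ hFm hB hFdep hδ hΔ hm
  simpa using h

/-- **BOUNDARY DECAY versus every DLR state** (`β_W = 1 / 4`, same ball and rate). [folklore] -/
theorem su2_boundaryDLR_onBallZdW_star_oneQuarter {W : Potential (ZdEdge 4) (SUN 2)}
    (hW : MemBallZdW (1 / 100) (27 / 250) (27 / 500) W) {μ : Measure (LGConfig 4 (SUN 2))}
    (hμ : μ ∈ perturbedGibbsMeasuresS (d := 4) (fundamentalRep (Fin 2)) (1 / 8) W)
    (Λ₀ : Finset (ZdEdge 4)) (η : LGConfig 4 (SUN 2)) (φ : ZdEdge 4 → ℝ)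
    (hφ : ∀ x y : ZdEdge 4, φ x ≤ φ y + ‖x.1 - y.1‖) (hφΛ : ∀ x, 0 < φ x → x ∈ Λ₀)
    {F : LGConfig 4 (SUN 2) → ℝ} (hFm : Measurable F) {B : ℝ} (hB : ∀ σ, |F σ| ≤ B) {Δ : Finset (ZdEdge 4)}
    (hFdep : DependsOn F (Δ : Set (ZdEdge 4))) {δ : ZdEdge 4 → ℝ} (hδ : IsLipBound suFrobDist F δ) (hΔ : Δ ⊆ Λ₀) {m : ℝ}
    (hm : ∀ x ∈ Δ, m ≤ φ x) :
    |(∫ σ, F σ ∂(perturbedYMS (d := 4) (fundamentalRep (Fin 2)) (1 / 8) W Λ₀ η)) - ∫ σ, F σ ∂μ| ≤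
      2 * Real.sqrt 2 * Real.exp (1 / 1000000) * Real.exp (-(1 / 1000000 * m)) * ∑ x ∈ Δ, δ x := by
  obtain ⟨Bm, hBm⟩ := hW.summable
  have e : ((2 : ℕ) : ℝ) * ((1 / 4 : ℝ) / 4) = 1 / 8 := by norm_num
  have hdoor := su2_starWindowBoundZdW_star_oneQuarter W hW
  rw [e] at hdoor
  have h := abs_kernel_sub_integral_le_of_starWindowBoundZdW
    (isSpecification_perturbedYMS _ (continuous_fundamentalRep (Fin 2)) _ hBm hW.continuous hW.dependsOn)
    (by norm_num) (by norm_num) (by norm_num) starReach_nonneg (fun s x hx y => norm_sub_le_starReach s hx y) hdoor hμ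
    Λ₀ η φ hφ hφΛ hFm hB hFdep hδ hΔ hm
  simpa using h

/-- **BOUNDARY DECAY, two boundary fields** (`β_W = 3 / 10`, ball `MemBallZdW (1/100) (27 / 500) (27 / 1000)`, rate `10⁻⁶`). [folklore] -/
theorem su2_boundaryDecay_onBallZdW_star_threeTenths {W : Potential (ZdEdge 4) (SUN 2)}
    (hW : MemBallZdW (1 / 100) (27 / 500) (27 / 1000) W) (Λ₀ : Finset (ZdEdge 4)) (ω η : LGConfig 4 (SUN 2)) (φ : ZdEdge 4 → ℝ)
    (hφ : ∀ x y : ZdEdge 4, φ x ≤ φ y + ‖x.1 - y.1‖) (hφΛ : ∀ x, 0 < φ x → x ∈ Λ₀)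
    {F : LGConfig 4 (SUN 2) → ℝ} (hFm : Measurable F) {B : ℝ} (hB : ∀ σ, |F σ| ≤ B) {Δ : Finset (ZdEdge 4)}
    (hFdep : DependsOn F (Δ : Set (ZdEdge 4))) {δ : ZdEdge 4 → ℝ} (hδ : IsLipBound suFrobDist F δ) (hΔ : Δ ⊆ Λ₀) {m : ℝ}
    (hm : ∀ x ∈ Δ, m ≤ φ x) :
    |∫ σ, F σ ∂(perturbedYMS (d := 4) (fundamentalRep (Fin 2)) (3 / 20) W Λ₀ ω) -
        ∫ σ, F σ ∂(perturbedYMS (d := 4) (fundamentalRep (Fin 2)) (3 / 20) W Λ₀ η)| ≤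
      2 * Real.sqrt 2 * Real.exp (1 / 1000000) * Real.exp (-(1 / 1000000 * m)) * ∑ x ∈ Δ, δ x := by
  obtain ⟨Bm, hBm⟩ := hW.summable
  have e : ((2 : ℕ) : ℝ) * ((3 / 10 : ℝ) / 4) = 3 / 20 := by norm_num
  have hdoor := su2_starWindowBoundZdW_star_threeTenths W hW
  rw [e] at hdoor
  have h := abs_kernel_sub_kernel_le_of_starWindowBoundZdW
    (isSpecification_perturbedYMS _ (continuous_fundamentalRep (Fin 2)) _ hBm hW.continuous hW.dependsOn)
    (by norm_num) (by norm_num) (by norm_num) starReach_nonneg (fun s x hx y => norm_sub_le_starReach s hx y) hdoor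
    Λ₀ ω η φ hφ hφΛ hFm hB hFdep hδ hΔ hm
  simpa using h

/-- **BOUNDARY DECAY versus every DLR state** (`β_W = 3 / 10`, same ball and rate). [folklore] -/
theorem su2_boundaryDLR_onBallZdW_star_threeTenths {W : Potential (ZdEdge 4) (SUN 2)}
    (hW : MemBallZdW (1 / 100) (27 / 500) (27 / 1000) W) {μ : Measure (LGConfig 4 (SUN 2))}
    (hμ : μ ∈ perturbedGibbsMeasuresS (d := 4) (fundamentalRep (Fin 2)) (3 / 20) W)
    (Λ₀ : Finset (ZdEdge 4)) (η : LGConfig 4 (SUN 2)) (φ : ZdEdge 4 → ℝ)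
    (hφ : ∀ x y : ZdEdge 4, φ x ≤ φ y + ‖x.1 - y.1‖) (hφΛ : ∀ x, 0 < φ x → x ∈ Λ₀)
    {F : LGConfig 4 (SUN 2) → ℝ} (hFm : Measurable F) {B : ℝ} (hB : ∀ σ, |F σ| ≤ B) {Δ : Finset (ZdEdge 4)}
    (hFdep : DependsOn F (Δ : Set (ZdEdge 4))) {δ : ZdEdge 4 → ℝ} (hδ : IsLipBound suFrobDist F δ) (hΔ : Δ ⊆ Λ₀) {m : ℝ}
    (hm : ∀ x ∈ Δ, m ≤ φ x) :
    |(∫ σ, F σ ∂(perturbedYMS (d := 4) (fundamentalRep (Fin 2)) (3 / 20) W Λ₀ η)) - ∫ σ, F σ ∂μ| ≤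
      2 * Real.sqrt 2 * Real.exp (1 / 1000000) * Real.exp (-(1 / 1000000 * m)) * ∑ x ∈ Δ, δ x := by
  obtain ⟨Bm, hBm⟩ := hW.summable
  have e : ((2 : ℕ) : ℝ) * ((3 / 10 : ℝ) / 4) = 3 / 20 := by norm_num
  have hdoor := su2_starWindowBoundZdW_star_threeTenths W hW
  rw [e] at hdoor
  have h := abs_kernel_sub_integral_le_of_starWindowBoundZdW
    (isSpecification_perturbedYMS _ (continuous_fundamentalRep (Fin 2)) _ hBm hW.continuous hW.dependsOn)
    (by norm_num) (by norm_num) (by norm_num) starReach_nonneg (fun s x hx y => norm_sub_le_starReach s hx y) hdoor hμ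
    Λ₀ η φ hφ hφΛ hFm hB hFdep hδ hΔ hm
  simpa using h

/-- **BOUNDARY DECAY, two boundary fields** (`β_W = 1 / 3`, ball `MemBallZdW (1/100) (11 / 500) (11 / 1000)`, rate `10⁻⁶`). [folklore] -/
theorem su2_boundaryDecay_onBallZdW_star_oneThird {W : Potential (ZdEdge 4) (SUN 2)}
    (hW : MemBallZdW (1 / 100) (11 / 500) (11 / 1000) W) (Λ₀ : Finset (ZdEdge 4)) (ω η : LGConfig 4 (SUN 2)) (φ : ZdEdge 4 → ℝ)
    (hφ : ∀ x y : ZdEdge 4, φ x ≤ φ y + ‖x.1 - y.1‖) (hφΛ : ∀ x, 0 < φ x → x ∈ Λ₀)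
    {F : LGConfig 4 (SUN 2) → ℝ} (hFm : Measurable F) {B : ℝ} (hB : ∀ σ, |F σ| ≤ B) {Δ : Finset (ZdEdge 4)}
    (hFdep : DependsOn F (Δ : Set (ZdEdge 4))) {δ : ZdEdge 4 → ℝ} (hδ : IsLipBound suFrobDist F δ) (hΔ : Δ ⊆ Λ₀) {m : ℝ}
    (hm : ∀ x ∈ Δ, m ≤ φ x) :
    |∫ σ, F σ ∂(perturbedYMS (d := 4) (fundamentalRep (Fin 2)) (1 / 6) W Λ₀ ω) -
        ∫ σ, F σ ∂(perturbedYMS (d := 4) (fundamentalRep (Fin 2)) (1 / 6) W Λ₀ η)| ≤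
      2 * Real.sqrt 2 * Real.exp (1 / 1000000) * Real.exp (-(1 / 1000000 * m)) * ∑ x ∈ Δ, δ x := by
  obtain ⟨Bm, hBm⟩ := hW.summable
  have e : ((2 : ℕ) : ℝ) * ((1 / 3 : ℝ) / 4) = 1 / 6 := by norm_num
  have hdoor := su2_starWindowBoundZdW_star_oneThird W hW
  rw [e] at hdoor
  have h := abs_kernel_sub_kernel_le_of_starWindowBoundZdW
    (isSpecification_perturbedYMS _ (continuous_fundamentalRep (Fin 2)) _ hBm hW.continuous hW.dependsOn)
    (by norm_num) (by norm_num) (by norm_num) starReach_nonneg (fun s x hx y => norm_sub_le_starReach s hx y) hdoor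
    Λ₀ ω η φ hφ hφΛ hFm hB hFdep hδ hΔ hm
  simpa using h

/-- **BOUNDARY DECAY versus every DLR state** (`β_W = 1 / 3`, same ball and rate). [folklore] -/
theorem su2_boundaryDLR_onBallZdW_star_oneThird {W : Potential (ZdEdge 4) (SUN 2)}
    (hW : MemBallZdW (1 / 100) (11 / 500) (11 / 1000) W) {μ : Measure (LGConfig 4 (SUN 2))}
    (hμ : μ ∈ perturbedGibbsMeasuresS (d := 4) (fundamentalRep (Fin 2)) (1 / 6) W)
    (Λ₀ : Finset (ZdEdge 4)) (η : LGConfig 4 (SUN 2)) (φ : ZdEdge 4 → ℝ)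
    (hφ : ∀ x y : ZdEdge 4, φ x ≤ φ y + ‖x.1 - y.1‖) (hφΛ : ∀ x, 0 < φ x → x ∈ Λ₀)
    {F : LGConfig 4 (SUN 2) → ℝ} (hFm : Measurable F) {B : ℝ} (hB : ∀ σ, |F σ| ≤ B) {Δ : Finset (ZdEdge 4)}
    (hFdep : DependsOn F (Δ : Set (ZdEdge 4))) {δ : ZdEdge 4 → ℝ} (hδ : IsLipBound suFrobDist F δ) (hΔ : Δ ⊆ Λ₀) {m : ℝ}
    (hm : ∀ x ∈ Δ, m ≤ φ x) :
    |(∫ σ, F σ ∂(perturbedYMS (d := 4) (fundamentalRep (Fin 2)) (1 / 6) W Λ₀ η)) - ∫ σ, F σ ∂μ| ≤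
      2 * Real.sqrt 2 * Real.exp (1 / 1000000) * Real.exp (-(1 / 1000000 * m)) * ∑ x ∈ Δ, δ x := by
  obtain ⟨Bm, hBm⟩ := hW.summable
  have e : ((2 : ℕ) : ℝ) * ((1 / 3 : ℝ) / 4) = 1 / 6 := by norm_num
  have hdoor := su2_starWindowBoundZdW_star_oneThird W hW
  rw [e] at hdoor
  have h := abs_kernel_sub_integral_le_of_starWindowBoundZdW
    (isSpecification_perturbedYMS _ (continuous_fundamentalRep (Fin 2)) _ hBm hW.continuous hW.dependsOn)
    (by norm_num) (by norm_num) (by norm_num) starReach_nonneg (fun s x hx y => norm_sub_le_starReach s hx y) hdoor hμ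
    Λ₀ η φ hφ hφΛ hFm hB hFdep hδ hΔ hm
  simpa using h

end Summit.Ventures.YMGap.RobustBall

end
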